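import Summits.CriticalPhenomena.SAWScalingLimit.Theorems.SAWRenewalTightnessAnnularMassDecayFirstDescentFactorisation
import Summits.CriticalPhenomena.SAWScalingLimit.Theorems.SAWRenewalTightnessAnnularMassDecayChainDecay

/-!
# The reduction of the crux `AnnularMassDecay` to the chain-stopped family (line `radial-renewal-kesten-inequality`)

Lead prover of the crux `Summit.CriticalPhenomena.SAWScalingLimit.Theses.SAWRenewalTightness.AnnularMassDecay`
(stmt-CriticalPhenomena-4729), line `radial-renewal-kesten-inequality` (skeleton
`Cruxes/AnnularMassDecay/Lines/radial_renewal_kesten_inequality.lean`).  This file makes the line's REDUCTION importable: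

* `rr_annularMassDecay_of_chainDecay` (registered helper) — the transfer `C⁺ → crux`: decay of the chain-stopped mass
  `D(u;r)[N] ≤ C (r/ρ_u)^θ` for `1 ≤ r < ρ_u = dist (Site.toComplex u) z` (the conclusion `ChainDecay` of the landed
  `stub_chainDecay`) implies `AnnularMassDecay` with the same `θ` and the constant `max C 0`.  An annular bridge of the crux
  (interior in `r < |·−z| < R`, end in `|·−z| ≤ r`, `1 ≤ r < R ≤ ρ_u`) is a member of the level-`r` chain-stopped family of
  `u` (`n > 0`; confined to `D_R ⊆ D_{ρ_u}`; its end is a strict radial record; every interior time, renewal or not, has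
  radius `> r`), and `(r/ρ_u)^θ ≤ (r/R)^θ`.  Uses the load-bearing hypothesis `R ≤ ρ_u` of the crux essentially.
* `rr_annularMassDecay_of_atoms` — hence, with the landed S4 (`stub_firstDescentFactorisation`) and S5 (`stub_chainDecay`),
  the crux follows from the three OPEN single-scale atoms of the line alone: S1 (chain boundedness `∃ K₀`), S2 (death seed
  `∃ A > 1, ε > 0`, mass at level `ρ_u/A` at most `1 − ε`) and S3 (skip tail with a rate `C·B^{-κ}`), all stated verbatim as
  registered on the item.  This is the standing partial result of the line: `AnnularMassDecay ⟸ S1 ∧ S2 ∧ S3`.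

No statement is weakened or asserted; both theorems are implications. [folklore]
-/

noncomputable section

namespace Summit.CriticalPhenomena.SAWScalingLimit.Theorems.AnnularMassDecay.Radial

open scoped BigOperators Classical
open Literature.Probability.LatticeModels Literature.Probability.RandomPlanarGeometry
open Summit.CriticalPhenomena.SAWScalingLimit.Theses.SAWRenewalTightness (AnnularMassDecay)
open Summit.CriticalPhenomena.SAWScalingLimit.Theorems.AnnularMassDecay.Negative (criticalFugacity_pos)

/-- **Transfer `ChainDecay → AnnularMassDecay`.**  If the chain-stopped mass decays, `D(u;r)[N] ≤ C (r/ρ_u)^θ` for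
`1 ≤ r < ρ_u`, then the crux holds with the same `θ` and constant `max C 0`: the crux's annular bridges from `u` with
`R ≤ ρ_u` are level-`r` members, and `(r/ρ_u)^θ ≤ (r/R)^θ`. [folklore] -/
theorem rr_annularMassDecay_of_chainDecay :
    (∃ θ C : ℝ, 0 < θ ∧ ∀ (z : ℂ) (u : Site 2) (r : ℝ), 1 ≤ r → r < dist (Site.toComplex u) z → ∀ N : ℕ,
          (∑ n ∈ Finset.range (N + 1),
            ∑ _ω ∈ (SAW.Zd.saws 2 n).filter (fun ω =>
              0 < n ∧
              (∀ i, 0 < i → i ≤ n → dist (Site.toComplex (u + ω i)) z < dist (Site.toComplex u) z) ∧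
              (∀ i, i < n → dist (Site.toComplex (u + ω n)) z < dist (Site.toComplex (u + ω i)) z) ∧
              dist (Site.toComplex (u + ω n)) z ≤ r ∧
              (∀ t, 0 < t → t < n →
                (∀ i, i < t → dist (Site.toComplex (u + ω t)) z < dist (Site.toComplex (u + ω i)) z) →
                (∀ j, t < j → j ≤ n → dist (Site.toComplex (u + ω j)) z < dist (Site.toComplex (u + ω t)) z) →
                r < dist (Site.toComplex (u + ω t)) z)),
              SAW.criticalFugacity ^ n) ≤ C * (r / dist (Site.toComplex u) z) ^ θ) →
    Summit.CriticalPhenomena.SAWScalingLimit.Theses.SAWRenewalTightness.AnnularMassDecay := by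
  rintro ⟨θ, C, hθ, hD⟩
  refine ⟨θ, max C 0, hθ, fun z r R hr hrR u hRu N => ?_⟩
  have hRpos : 0 < R := by linarith
  have hrρ : r < dist (Site.toComplex u) z := lt_of_lt_of_le hrR hRu
  have key := hD z u r hr hrρ N
  refine le_trans ?_ (key.trans ?_)
  · -- the crux family is a sub-family of the level-`r` chain-stopped family of `u`
    refine Finset.sum_le_sum fun n _ => ?_
    refine Finset.sum_le_sum_of_subset_of_nonneg ?_ fun _ _ _ => pow_nonneg criticalFugacity_pos.le _
    intro ω hω
    rw [Finset.mem_filter] at hω ⊢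
    obtain ⟨hωs, hint, hend⟩ := hω
    have h0 : ω 0 = 0 := (SAW.Zd.mem_saws.1 hωs).1
    have hd0 : dist (Site.toComplex (u + ω 0)) z = dist (Site.toComplex u) z := by rw [h0, add_zero]
    refine ⟨hωs, ?_, ?_, ?_, hend, ?_⟩
    · rcases Nat.eq_zero_or_pos n with hn | hn
      · exfalso
        subst hn
        rw [hd0] at hend
        linarith
      · exact hn
    · intro i hi0 hin
      rcases hin.lt_or_eq with hlt | heq
      · exact (hint i hi0 hlt).2.trans_le hRu
      · rw [heq]
        exact lt_of_le_of_lt hend hrρ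
    · intro i hin
      rcases Nat.eq_zero_or_pos i with hi0 | hi0
      · subst hi0
        rw [hd0]
        exact lt_of_le_of_lt hend hrρ
      · exact lt_of_le_of_lt hend (hint i hi0 hin).1
    · intro t ht0 htn _ _
      exact (hint t ht0 htn).1
  · -- `C (r/|u-z|)^θ ≤ max C 0 · (r/R)^θ`
    have hq0 : 0 ≤ r / dist (Site.toComplex u) z := div_nonneg (by linarith) (by linarith)
    calc C * (r / dist (Site.toComplex u) z) ^ θ ≤ max C 0 * (r / dist (Site.toComplex u) z) ^ θ :=
          mul_le_mul_of_nonneg_right (le_max_left _ _) (Real.rpow_nonneg hq0 θ)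
      _ ≤ max C 0 * (r / R) ^ θ :=
          mul_le_mul_of_nonneg_left
            (Real.rpow_le_rpow hq0 (div_le_div_of_nonneg_left (by linarith) hRpos hRu) hθ.le)
            (le_max_right _ _)

/-- **The line's standing reduction `AnnularMassDecay ⟸ S1 ∧ S2 ∧ S3`.**  The three open single-scale atoms of the line
— chain boundedness (S1), the death seed at one ratio (S2) and the skip tail with a rate (S3), verbatim as registered on
stmt-CriticalPhenomena-4729 — imply the crux, through the landed first-`A`-descent factorisation (S4,
`stub_firstDescentFactorisation`), the landed renewal-inequality induction (S5, `stub_chainDecay`) and the transfer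
`rr_annularMassDecay_of_chainDecay`. [folklore] -/
theorem rr_annularMassDecay_of_atoms
    (h₁ : ∃ K₀ : ℝ, ∀ (z : ℂ) (u : Site 2) (s : ℝ), 1 ≤ s → ∀ N : ℕ,
            (∑ n ∈ Finset.range (N + 1),
              ∑ _ω ∈ (SAW.Zd.saws 2 n).filter (fun ω =>
                0 < n ∧
                (∀ i, 0 < i → i ≤ n → dist (Site.toComplex (u + ω i)) z < dist (Site.toComplex u) z) ∧
                (∀ i, i < n → dist (Site.toComplex (u + ω n)) z < dist (Site.toComplex (u + ω i)) z) ∧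
                dist (Site.toComplex (u + ω n)) z ≤ s ∧
                (∀ t, 0 < t → t < n →
                  (∀ i, i < t → dist (Site.toComplex (u + ω t)) z < dist (Site.toComplex (u + ω i)) z) →
                  (∀ j, t < j → j ≤ n → dist (Site.toComplex (u + ω j)) z < dist (Site.toComplex (u + ω t)) z) →
                  s < dist (Site.toComplex (u + ω t)) z)),
                SAW.criticalFugacity ^ n) ≤ K₀)
    (h₂ : ∃ A ε : ℝ, 1 < A ∧ 0 < ε ∧ ∀ (z : ℂ) (u : Site 2) (N : ℕ),
            (∑ n ∈ Finset.range (N + 1),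
              ∑ _ω ∈ (SAW.Zd.saws 2 n).filter (fun ω =>
                0 < n ∧
                (∀ i, 0 < i → i ≤ n → dist (Site.toComplex (u + ω i)) z < dist (Site.toComplex u) z) ∧
                (∀ i, i < n → dist (Site.toComplex (u + ω n)) z < dist (Site.toComplex (u + ω i)) z) ∧
                dist (Site.toComplex (u + ω n)) z ≤ dist (Site.toComplex u) z / A ∧
                (∀ t, 0 < t → t < n →
                  (∀ i, i < t → dist (Site.toComplex (u + ω t)) z < dist (Site.toComplex (u + ω i)) z) →
                  (∀ j, t < j → j ≤ n → dist (Site.toComplex (u + ω j)) z < dist (Site.toComplex (u + ω t)) z) →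
                  dist (Site.toComplex u) z / A < dist (Site.toComplex (u + ω t)) z)),
                SAW.criticalFugacity ^ n) ≤ 1 - ε)
    (h₃ : ∀ A : ℝ, 1 < A → ∃ κ C : ℝ, 0 < κ ∧ ∀ B : ℝ, 1 ≤ B → ∀ (z : ℂ) (u : Site 2),
            A * B ≤ dist (Site.toComplex u) z → ∀ N : ℕ,
            (∑ n ∈ Finset.range (N + 1),
              ∑ _ω ∈ (SAW.Zd.saws 2 n).filter (fun ω =>
                dist (Site.toComplex (u + ω n)) z ≤ dist (Site.toComplex u) z / (A * B) ∧
                0 < n ∧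
                (∀ i, 0 < i → i ≤ n → dist (Site.toComplex (u + ω i)) z < dist (Site.toComplex u) z) ∧
                (∀ i, i < n → dist (Site.toComplex (u + ω n)) z < dist (Site.toComplex (u + ω i)) z) ∧
                dist (Site.toComplex (u + ω n)) z ≤ dist (Site.toComplex u) z / A ∧
                (∀ t, 0 < t → t < n →
                  (∀ i, i < t → dist (Site.toComplex (u + ω t)) z < dist (Site.toComplex (u + ω i)) z) →
                  (∀ j, t < j → j ≤ n → dist (Site.toComplex (u + ω j)) z < dist (Site.toComplex (u + ω t)) z) →
                  dist (Site.toComplex u) z / A < dist (Site.toComplex (u + ω t)) z)),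
                SAW.criticalFugacity ^ n) ≤ C * B ^ (-κ)) :
    AnnularMassDecay :=
  rr_annularMassDecay_of_chainDecay (stub_chainDecay stub_firstDescentFactorisation h₁ h₂ h₃)

end Summit.CriticalPhenomena.SAWScalingLimit.Theorems.AnnularMassDecay.Radial

end
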